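import Mathlib

/-!
# Block P glue (abstract, measure-agnostic) — seat p4

Kernel-checked forms of the two pieces of pure analysis in the planar block of this cell:

* `lower_bound_of_deriv_ge` — the integration step of SHARP-p4 Theorem S2 (the mean-field lower bound):
  from `f' ≥ (1 - f)/(q(1-q))` on `(a,1)` one gets `f p ≥ (p - a)/(p(1 - a))` for `p ∈ (a,1)`.
* `pc_eq_half_and_theta_pc_eq_zero` — the T2 assembly (T2-assembly-p4 Theorem T2): a monotone `θ` with
  `θ(½) = 0`, a crossing lower bound `½ ≤ (n+1) a(n+1)` and exponential decay of `a` whenever `½ < p_c`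
  force `p_c = ½` and `θ(p_c) = 0`.

The concrete inputs (monotonicity = L1, `θ(½) = 0` = P1, the crossing bound = P6(a) + F2, the decay = P5)
are supplied by the paper proofs; the statements are phrased for an arbitrary `θ : ℝ → ℝ` with
`p_c = sInf {p ∈ [0,1] | 0 < θ p}` (ROUTE-v3 §0, the definition of `Statement.lean`), so that they can be
instantiated verbatim once `Statement.lean` is in the tree. No definitions are made in this file.
-/

namespace Summit.Ventures.PercRepro0.Planar

open Real Set

/-- `(n+1)·e^{-c(n+1)} → 0` made explicit: for `c > 0` there is `n ≥ 1` with `(n+1) e^{-c(n+1)} < ½`.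
Elementary, from `e^x ≥ x²/2` for `x ≥ 0`: it suffices that `c²(n+1) > 4`. -/
theorem exists_nat_mul_exp_lt_half {c : ℝ} (hc : 0 < c) :
    ∃ n : ℕ, 1 ≤ n ∧ ((n : ℝ) + 1) * Real.exp (-(c * ((n : ℝ) + 1))) < 1 / 2 := by
  obtain ⟨N, hN⟩ := exists_nat_gt (4 / c ^ 2)
  refine ⟨N + 1, by omega, ?_⟩
  have hm : ((N + 1 : ℕ) : ℝ) + 1 = (N : ℝ) + 2 := by push_cast; ring
  rw [hm]
  set m : ℝ := (N : ℝ) + 2 with hm_def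
  have hm_pos : 0 < m := by positivity
  have h4 : 4 / c ^ 2 < m := by linarith
  have h4' : 4 < c ^ 2 * m := by
    have hc2 : 0 < c ^ 2 := by positivity
    rw [div_lt_iff₀ hc2] at h4
    linarith
  have hx : 0 ≤ c * m := by positivity
  have hexp : (c * m) ^ 2 / 2 ≤ Real.exp (c * m) := by
    have := Real.quadratic_le_exp_of_nonneg hx
    nlinarith
  have key : 2 * m < Real.exp (c * m) := by
    have h1 : 2 * m < (c * m) ^ 2 / 2 := by nlinarith
    linarith
  have hepos := Real.exp_pos (c * m)
  rw [Real.exp_neg, ← div_eq_mul_inv, div_lt_iff₀ hepos]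
  linarith

/-- **T2 assembly, abstract form** (T2-assembly-p4 Theorem T2). Let `θ : ℝ → ℝ` be nondecreasing on `[0,1]`
with `θ(½) = 0` (P1) and `θ(1) > 0`, and put `p_c := sInf {p ∈ [0,1] | 0 < θ p}`. Let `a n` stand for
`P_½(0 ↔ ∂Λ_n)`. If `½ ≤ (n+1)·a(n+1)` for all `n ≥ 1` (the crossing bound from P6(a), Lemma 2.2 and F2) and
`½ < p_c` implies exponential decay `a n ≤ e^{-cn}` (P5 at `p = ½`), then `p_c = ½` and `θ(p_c) = 0`. -/
theorem pc_eq_half_and_theta_pc_eq_zero (θ : ℝ → ℝ)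
    (hmono : MonotoneOn θ (Icc 0 1)) (hhalf : θ (1 / 2) = 0) (hone : 0 < θ 1)
    (a : ℕ → ℝ)
    (hcross : ∀ n : ℕ, 1 ≤ n → (1 : ℝ) / 2 ≤ ((n : ℝ) + 1) * a (n + 1))
    (hdecay : (1 : ℝ) / 2 < sInf {p : ℝ | p ∈ Icc (0 : ℝ) 1 ∧ 0 < θ p} →
      ∃ c : ℝ, 0 < c ∧ ∀ n : ℕ, 1 ≤ n → a n ≤ Real.exp (-(c * (n : ℝ)))) :
    sInf {p : ℝ | p ∈ Icc (0 : ℝ) 1 ∧ 0 < θ p} = 1 / 2 ∧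
      θ (sInf {p : ℝ | p ∈ Icc (0 : ℝ) 1 ∧ 0 < θ p}) = 0 := by
  set S := {p : ℝ | p ∈ Icc (0 : ℝ) 1 ∧ 0 < θ p} with hS
  have hne : S.Nonempty := ⟨1, ⟨⟨by norm_num, le_refl _⟩, hone⟩⟩
  -- Step 1: ½ ≤ p_c (P1 + L1).
  have hge : (1 : ℝ) / 2 ≤ sInf S := by
    apply le_csInf hne
    intro p hp
    by_contra hlt
    have hlt' : p < 1 / 2 := not_le.mp hlt
    have : θ p ≤ θ (1 / 2) := hmono hp.1 ⟨by norm_num, by norm_num⟩ hlt'.le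
    linarith [hp.2]
  -- Step 2: p_c ≤ ½ (P5 at ½ against the crossing bound).
  have hle : sInf S ≤ (1 : ℝ) / 2 := by
    by_contra hgt
    have hgt' : (1 : ℝ) / 2 < sInf S := not_le.mp hgt
    obtain ⟨c, hc, hdec⟩ := hdecay hgt'
    obtain ⟨n, hn1, hlt⟩ := exists_nat_mul_exp_lt_half hc
    have h1 := hcross n hn1
    have h2 : a (n + 1) ≤ Real.exp (-(c * ((n : ℝ) + 1))) := by
      have := hdec (n + 1) (by omega)
      simpa [Nat.cast_add, Nat.cast_one] using this
    have h3 : ((n : ℝ) + 1) * a (n + 1) ≤ ((n : ℝ) + 1) * Real.exp (-(c * ((n : ℝ) + 1))) :=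
      mul_le_mul_of_nonneg_left h2 (by positivity)
    linarith
  have heq : sInf S = 1 / 2 := le_antisymm hle hge
  exact ⟨heq, by rw [heq]; exact hhalf⟩

/-- **The integration step of Theorem S2** (SHARP-p4 §4). Let `f` be differentiable on `(0,1)` with values
in `[0,1)` there, let `0 < a < 1`, and suppose `f'(q) ≥ (1 - f q)/(q(1-q))` for every `q ∈ (a,1)`.
Then `f p ≥ (p - a)/(p(1 - a))` for every `p ∈ (a,1)`. (With `f = θ_n`, `a = p̃_c`: Lemma 4.1 + Lemma 2.3(b)
give the hypothesis, and letting `n → ∞` gives `θ(p) ≥ (p - p̃_c)/(p(1 - p̃_c))`.) -/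
theorem lower_bound_of_deriv_ge (f : ℝ → ℝ) (a : ℝ) (ha0 : 0 < a) (ha1 : a < 1)
    (hdiff : ∀ q ∈ Ioo (0 : ℝ) 1, DifferentiableAt ℝ f q)
    (hf0 : ∀ q ∈ Ioo (0 : ℝ) 1, 0 ≤ f q) (hf1 : ∀ q ∈ Ioo (0 : ℝ) 1, f q < 1)
    (hderiv : ∀ q ∈ Ioo a 1, (1 - f q) / (q * (1 - q)) ≤ deriv f q)
    {p : ℝ} (hp : p ∈ Ioo a 1) :
    (p - a) / (p * (1 - a)) ≤ f p := by
  -- the potential h q = log(1 - f q) + log q - log(1 - q), nonincreasing on (a,1)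
  set h : ℝ → ℝ := fun q => Real.log (1 - f q) + Real.log q - Real.log (1 - q) with hh
  have hderivh : ∀ q ∈ Ioo (0 : ℝ) 1,
      HasDerivAt h (-(deriv f q) / (1 - f q) + q⁻¹ - (-1) / (1 - q)) q := by
    intro q hq
    have hfq : HasDerivAt f (deriv f q) q := (hdiff q hq).hasDerivAt
    have h1 : HasDerivAt (fun y => 1 - f y) (-(deriv f q)) q := hfq.const_sub 1
    have h1' : (1 - f q) ≠ 0 := by have := hf1 q hq; linarith
    have hl1 : HasDerivAt (fun y => Real.log (1 - f y)) (-(deriv f q) / (1 - f q)) q := h1.log h1'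
    have hl2 : HasDerivAt Real.log q⁻¹ q := Real.hasDerivAt_log (ne_of_gt hq.1)
    have h3 : HasDerivAt (fun y : ℝ => 1 - y) (-1) q := (hasDerivAt_id' q).const_sub 1
    have h3' : (1 - q) ≠ 0 := by have := hq.2; linarith
    have hl3 : HasDerivAt (fun y => Real.log (1 - y)) ((-1) / (1 - q)) q := h3.log h3'
    exact (hl1.add hl2).sub hl3
  have hsub : ∀ x ∈ Icc a p, x ∈ Ioo (0 : ℝ) 1 := fun x hx =>
    ⟨by linarith [hx.1], by linarith [hx.2, hp.2]⟩
  have hanti : AntitoneOn h (Icc a p) := by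
    apply antitoneOn_of_deriv_nonpos (convex_Icc a p)
    · intro x hx
      exact (hderivh x (hsub x hx)).continuousAt.continuousWithinAt
    · intro x hx
      rw [interior_Icc] at hx
      exact (hderivh x (hsub x (Ioo_subset_Icc_self hx))).differentiableAt.differentiableWithinAt
    · intro x hx
      rw [interior_Icc] at hx
      have hx01 : x ∈ Ioo (0 : ℝ) 1 := hsub x (Ioo_subset_Icc_self hx)
      have hxa1 : x ∈ Ioo a 1 := ⟨hx.1, by linarith [hx.2, hp.2]⟩
      rw [(hderivh x hx01).deriv]
      have hu : 0 < 1 - f x := by linarith [hf1 x hx01]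
      have hx0 : 0 < x := hx01.1
      have hx1 : 0 < 1 - x := by linarith [hx01.2]
      have key : (1 - f x) / (x * (1 - x)) ≤ deriv f x := hderiv x hxa1
      have key2 : 1 / (x * (1 - x)) ≤ deriv f x / (1 - f x) := by
        rw [div_le_div_iff₀ (by positivity) hu]
        rw [div_le_iff₀ (by positivity)] at key
        linarith
      have key3 : x⁻¹ - (-1) / (1 - x) = 1 / (x * (1 - x)) := by
        field_simp
        ring
      have key4 : -(deriv f x) / (1 - f x) = -(deriv f x / (1 - f x)) := by ring
      linarith [key2, key3, key4]
  have hhp : h p ≤ h a := hanti ⟨le_refl a, hp.1.le⟩ ⟨hp.1.le, le_refl p⟩ hp.1.le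
  -- translate h p ≤ h a into (1 - f p) p/(1 - p) ≤ (1 - f a) a/(1 - a)
  have hp01 : p ∈ Ioo (0 : ℝ) 1 := ⟨by linarith [hp.1], hp.2⟩
  have ha01 : a ∈ Ioo (0 : ℝ) 1 := ⟨ha0, ha1⟩
  have hup : 0 < 1 - f p := by linarith [hf1 p hp01]
  have hua : 0 < 1 - f a := by linarith [hf1 a ha01]
  have hp0 : 0 < p := hp01.1
  have hp1 : 0 < 1 - p := by linarith [hp01.2]
  have ha1' : 0 < 1 - a := by linarith
  have hlogp : h p = Real.log ((1 - f p) * p / (1 - p)) := by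
    simp only [hh]
    rw [Real.log_div (by positivity) (by positivity), Real.log_mul (by positivity) (by positivity)]
  have hloga : h a = Real.log ((1 - f a) * a / (1 - a)) := by
    simp only [hh]
    rw [Real.log_div (by positivity) (by positivity), Real.log_mul (by positivity) (by positivity)]
  rw [hlogp, hloga, Real.log_le_log_iff (by positivity) (by positivity)] at hhp
  -- (1 - f a) ≤ 1 since f a ≥ 0
  have hfa0 : 0 ≤ f a := hf0 a ha01
  have hbound : (1 - f p) * p / (1 - p) ≤ a / (1 - a) := by
    calc (1 - f p) * p / (1 - p) ≤ (1 - f a) * a / (1 - a) := hhp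
      _ ≤ 1 * a / (1 - a) := by
        apply div_le_div_of_nonneg_right _ ha1'.le
        nlinarith
      _ = a / (1 - a) := by ring
  rw [div_le_div_iff₀ hp1 ha1'] at hbound
  rw [div_le_iff₀ (by positivity)]
  nlinarith

end Summit.Ventures.PercRepro0.Planar
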